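import Summits.BirchSwinnertonDyer.BirchSwinnertonDyer.Theorems.AdditiveBranchIMCGordTwoTwistedWanDefs
import Summits.BirchSwinnertonDyer.BirchSwinnertonDyer.Theorems.AdditiveBranchIMCTameAnticycRestriction
import Summits.BirchSwinnertonDyer.BirchSwinnertonDyer.Theorems.AdditiveBranchIMCGenusKolyvaginPlacesNonsplit
import Summits.BirchSwinnertonDyer.Rank1Residual.Additive.CyclotomicThreeMultiplicativeReduction
import Summits.BirchSwinnertonDyer.Rank1Residual.Additive.CyclotomicPrimeMultiplicativeReduction
import Literature.NumberTheory.EllipticCurves.Hsieh2014.AnticyclotomicPAdicLFunctionRamifiedTwistedSteinberg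
import HarnessLib

/-!
# Route `AdditiveBranchIMC`, crux `GordTwoRankZeroOffCaseOne` (19357), line `three_field_road`, stub `stub_jointLowerTwistedR0`:
# the TWISTED road field's local clause over `K` and its ♭-frame of unit content (LEAD g16; `--supports` 19357, helper only)

Theorems only (no definition, no named fact, no `sorry`); nothing about BSD is asserted and the crux stays OPEN. Three pieces of the
kernel port of FIELD 1 (`WanAnyRoad.jointLowerBoundAt_wanAny`) to the twisted road field `TwistedWanRoad.TameRoadFieldTwisted` (road prime
`q` ADDITIVE for `E`, potentially multiplicative of twist type, RAMIFIED in `K` in the non-split class):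

* §1 `baseChange_nonsplit_of_nonsplitClass` — THE BASE-CHANGE CLAUSE (S4‴) of the typed readings R2/R3/R4 (wi-99842/3/4): for an odd prime
  `ℓ₀ ∣ d_K` with `W₁ = E^{(ℓ₀*)}` multiplicative at `ℓ₀` and `K` in the non-split class (`NonsplitClassAt`), `E/K` has NON-SPLIT multiplicative
  reduction at every prime of `K` above `ℓ₀`. Proof: over `K = ℚ(√d_K)` the twist `Wd ≅ E^{(d_K)}` is `K`-isomorphic to `E`
  (`GenusKolyvagin.exists_variableChange_baseChange_of_quadraticTwist_discr`); a globally minimal `Wd` is multiplicative NON-split at `ℓ₀` over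
  `ℚ` (`TwistRootNumberTwisted.quadraticTwist_discr_nonsplit_at_of_nonsplitClass`, p797470); multiplicative reduction passes to `K`
  (`isMinimalAt_and_hasMultiplicativeReductionAt_baseChange_of_mult`) and non-split persists at the degree-one place above the ramified `ℓ₀`
  (`absNorm_eq_of_ncard_eq_two_or_dvd_discr`, `not_hasSplitMultiplicativeReductionAt_baseChange_of_not_split_prime`); both predicates are
  invariant under the `K`-isomorphism (`hasMultiplicativeReductionAt_smul_iff_holds`, `hasSplitMultiplicativeReductionAt_smul_iff_holds`).
* §2 `exists_frameInt_unitContent_twisted` — the sibling of `TameBranchSocket.exists_frameInt_unitContent_ramifiedSteinberg` (p697xxx): a ♭-frame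
  `(Ω_K ≠ 0, Ω_p ∈ R₀ˣ, Q ∈ 𝓞_{ℂ_p}⟦T⟧)` with `R1.IsBDPLFunctionInt p ι′ 𝔭 κ γ f_E Ω_K Ω_p Q` AND a unit coefficient, from Hsieh 2014 Thm. B in the
  twisted reading (`Hsieh2014.thmB_exists_isHsiehLFunction_coeff_norm_eq_one_unrPeriod_ramifiedTwistedSteinberg`, R3, f_E-keyed frame, first cut
  `p ∤ ℓ₀ + 1`) through the λ-supply and the Hsieh→Castella glue — verbatim the sibling's proof with the (S4′) block replaced by (S4‴).
* §3 `exists_frame_and_restriction_twisted` — the sibling of `TameAnticycRestriction.exists_frame_and_restriction` (p715340): the anticyclotomic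
  restriction `A(0,·) = B(0,·)·D`, `D ≠ 0`, `(D) ⊆ (Q′)` of a CLW pair at a twisted-road configuration (§2's frame, then the q-free
  `TameAnticycRestriction.exists_constantCoeff_eq_mul`).

References: Hsieh, Doc. Math. 19 (2014) Thm. B; Castella–Liu–Wan 2022 (1.0.3), Thm. 8.2.1; Castella 2018 Thm. 3.1; Silverman AEC VII.5 Prop. 5.1,
5.4, X.5 Cor. 5.4. presearch: n/a (kernel port over typed readings; no new printed input).
-/

noncomputable section

open scoped Classical

set_option linter.dupNamespace false
set_option autoImplicit false

open NumberField IsDedekindDomain IsDedekindDomain.HeightOneSpectrum Rat.HeightOneSpectrum Field PowerSeries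
open WeierstrassCurve Literature.NumberTheory.EllipticCurves
  Literature.NumberTheory.EllipticCurves.ModularForms
  Literature.NumberTheory.EllipticCurves.Rank1Residual
  Literature.NumberTheory.EllipticCurves.Rank1Residual.Typed
  Literature.NumberTheory.EllipticCurves.GreenbergVatsal2000
  Literature.NumberTheory.EllipticCurves.CastellaLiuWan2022
  Literature.NumberTheory.GaloisRepresentations
  Literature.NumberTheory.GaloisCohomology
open Summit.BirchSwinnertonDyer.Rank1Residual
open Summit.BirchSwinnertonDyer.Rank1Residual.Additive
open Summit.BirchSwinnertonDyer.Rank1Residual.X11b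
open Summit.BirchSwinnertonDyer.BirchSwinnertonDyer.Theorems

namespace Summit.BirchSwinnertonDyer.BirchSwinnertonDyer.Theorems.TwistedWanRoad

/-! ## §1 The base-change clause (S4‴): `E/K` is non-split multiplicative above the twisted Wan prime -/

/-- **`E/K_λ` IS NON-SPLIT MULTIPLICATIVE at every prime `λ` of `K` above the twisted Wan prime.** For `E/ℚ` (globally minimal `W`), an odd
prime `ℓ₀` with `W₁ = E^{(ℓ₀*)}` multiplicative at `ℓ₀`, and an imaginary quadratic `K` with `ℓ₀ ∣ d_K` in the non-split class
(`legendreSym ℓ₀ (d_K/ℓ₀*) = −1` if `W₁` is split at `ℓ₀`, `+1` if not): `(W.baseChange K)` has multiplicative, not split multiplicative,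
reduction at every `v ∋ ℓ₀`. This is the binder «`∀ v ∋ ℓ₀, (W.baseChange K).HasMultiplicativeReductionAt v ∧ ¬ …Split…`» of the typed
readings R2 (Castella–Liu–Wan, ramified twist prime), R3 (Hsieh Thm. A/B, twisted Steinberg) and R4 (Liu–Zhang–Zhang, twisted).
[cite: SilvermanAEC2009, VII.5 Prop. 5.1 (b), Prop. 5.4 (b), X.5 Cor. 5.4] -/
theorem baseChange_nonsplit_of_nonsplitClass (W : WeierstrassCurve ℚ) [W.IsElliptic] [W.IsGloballyMinimal]
    {ℓ₀ : ℕ} [hℓ₀ : Fact ℓ₀.Prime] (hℓ₀2 : ℓ₀ ≠ 2)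
    (hmult₀ : (W.quadraticTwist (((-1 : ℤ) ^ (ℓ₀ / 2) * ℓ₀ : ℤ) : ℚ)).HasMultiplicativeReductionAtPrime ℓ₀)
    (K : Type) [Field K] [NumberField K] (hK : IsImaginaryQuadratic K)
    (hℓ₀K : (ℓ₀ : ℤ) ∣ NumberField.discr K)
    (hclass : legendreSym ℓ₀ (NumberField.discr K / ((-1 : ℤ) ^ (ℓ₀ / 2) * ℓ₀)) =
      (if (W.quadraticTwist (((-1 : ℤ) ^ (ℓ₀ / 2) * ℓ₀ : ℤ) : ℚ)).HasSplitMultiplicativeReductionAtPrime ℓ₀ then -1 else 1)) :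
    ∀ v : HeightOneSpectrum (𝓞 K), ((ℓ₀ : ℕ) : 𝓞 K) ∈ v.asIdeal →
      (W.baseChange K).HasMultiplicativeReductionAt v ∧ ¬ (W.baseChange K).HasSplitMultiplicativeReductionAt v := by
  intro v hv
  haveI : (W.baseChange K).IsElliptic := by rw [baseChange]; infer_instance
  -- a globally minimal model `Wd` of `E^{(d_K)}`; it is multiplicative NON-split at `ℓ₀` over `ℚ`
  have hD0 : (NumberField.discr K : ℚ) ≠ 0 := by exact_mod_cast NumberField.discr_ne_zero K
  haveI : (W.quadraticTwist (NumberField.discr K : ℚ)).IsElliptic := W.isElliptic_quadraticTwist hD0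
  obtain ⟨Cd, hCd⟩ := hasGlobalMinimalModel_rat_holds (W.quadraticTwist (NumberField.discr K : ℚ))
  haveI : (Cd • W.quadraticTwist (NumberField.discr K : ℚ)).IsGloballyMinimal := hCd
  set Wd := Cd • W.quadraticTwist (NumberField.discr K : ℚ) with hWd
  haveI : (Wd.baseChange K).IsElliptic := by rw [baseChange]; infer_instance
  obtain ⟨hmd, hnsd⟩ := TwistRootNumberTwisted.quadraticTwist_discr_nonsplit_at_of_nonsplitClass W hℓ₀2 hmult₀ K hK hℓ₀K
    hclass Wd ⟨Cd, rfl⟩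
  -- over `K = ℚ(√d_K)`: `Wd ⊗ K = C′ • (E ⊗ K)`
  obtain ⟨C', hC'⟩ := GenusKolyvagin.exists_variableChange_baseChange_of_quadraticTwist_discr hK.1 W Wd ⟨Cd, rfl⟩
  -- `Wd ⊗ K` is multiplicative at `v`, and not split (`N(v) = ℓ₀`: `ℓ₀` is ramified)
  have hmv : (Wd.baseChange K).HasMultiplicativeReductionAt v :=
    (isMinimalAt_and_hasMultiplicativeReductionAt_baseChange_of_mult Wd (p := ℓ₀) hmd v hv).2
  have hN : Ideal.absNorm v.asIdeal = ℓ₀ :=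
    GenusKolyvagin.absNorm_eq_of_ncard_eq_two_or_dvd_discr hK.1 hℓ₀.out v hv (Or.inr hℓ₀K)
  have hnsv : ¬ (Wd.baseChange K).HasSplitMultiplicativeReductionAt v :=
    not_hasSplitMultiplicativeReductionAt_baseChange_of_not_split_prime Wd ℓ₀ v hv hN hmd hnsd
  -- transport along the `K`-isomorphism
  rw [← hC'] at hmv hnsv
  exact ⟨(WeierstrassCurve.hasMultiplicativeReductionAt_smul_iff_holds v (W.baseChange K) C').mp hmv,
    fun h ↦ hnsv ((WeierstrassCurve.hasSplitMultiplicativeReductionAt_smul_iff_holds v (W.baseChange K) C').mpr h)⟩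

/-- **The base-change clause read off the line's predicates** (`TwistedWanPrime W p q ∧ NonsplitClassAt W q K`, `K` imaginary quadratic).
[cite: SilvermanAEC2009, VII.5 Prop. 5.1 (b), Prop. 5.4 (b), X.5 Cor. 5.4] -/
theorem baseChange_nonsplit_of_twistedWanPrime (W : WeierstrassCurve ℚ) [W.IsElliptic] [W.IsGloballyMinimal] (p : ℕ)
    {q : ℕ} [Fact q.Prime] (K : Type) [Field K] [NumberField K] (hK : IsImaginaryQuadratic K)
    (hq : TwistedWanPrime W p q) (hcl : NonsplitClassAt W q K) :
    ∀ v : HeightOneSpectrum (𝓞 K), ((q : ℕ) : 𝓞 K) ∈ v.asIdeal →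
      (W.baseChange K).HasMultiplicativeReductionAt v ∧ ¬ (W.baseChange K).HasSplitMultiplicativeReductionAt v :=
  baseChange_nonsplit_of_nonsplitClass W hq.2.1 hq.2.2.2.1 K hK hcl.1 hcl.2

/-! ## §2 A ♭-frame of UNIT content over a twisted-road configuration (Hsieh 2014 Thm. B, twisted reading R3) -/

/-- **A ♭-frame OF UNIT CONTENT EXISTS over a twisted-road configuration** (sibling of
`TameBranchSocket.exists_frameInt_unitContent_ramifiedSteinberg`, (S4′) ↦ (S4‴)): for every embedding datum `ι′` inducing `𝔭`, Hsieh 2014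
Thm. B in the twisted-Steinberg reading (`hB`; (irr_K) supplied as `hirr`) gives `Ω_K ≠ 0`, `Ω_p ∈ R₀ˣ` and `Q ∈ 𝓞_{ℂ_p}⟦T⟧` with
`R1.IsBDPLFunctionInt p ι′ 𝔭 κ γ f Ω_K Ω_p Q` AND a unit coefficient, for any newform `f` of `W` of level `N`, `p ∣ N`, an odd `ℓ₀ ≠ p` with
`ℓ₀ ∣ d_K`, `W^{(ℓ₀*)}` multiplicative at `ℓ₀`, `E/K` non-split multiplicative above `ℓ₀`, every other `ℓ ∣ N` split, `p ∤ ℓ₀ + 1`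
(λ-supply `X11b.lambdaSupplyAt`; glue `X11b.exists_isBDPLFunctionInt_of_isHsiehLFunction` multiplies by a constant of norm one).
CONDITIONAL on `hB`. [cite: Hsieh2014, Thm. B p. 713 (Doc. Math. 19) = Thm. 2 (arXiv:1112.1580 p. 4), Thm. 6.2 (p. 25)]
[cite: Castella2018, Thm. 3.1 (arXiv:1704.06608 p. 9) (shape)] -/
theorem exists_frameInt_unitContent_twisted {p : ℕ} [Fact p.Prime]
    (hB : Hsieh2014.thmB_exists_isHsiehLFunction_coeff_norm_eq_one_unrPeriod_ramifiedTwistedSteinberg)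
    (W : WeierstrassCurve ℚ) [W.IsElliptic]
    (K : Type) [Field K] [NumberField K] (𝔭 : HeightOneSpectrum (𝓞 K))
    (κ : ZpExtension K p) (γ : absoluteGaloisGroup K) [Fact (κ.IsTopGenerator γ)] {N : ℕ} [NeZero N]
    (f : CuspForm (CongruenceSubgroup.Gamma0 N) 2) (hfW : IsNewformOf W f) (ℓ₀ : ℕ) [Fact ℓ₀.Prime]
    (hp2 : p ≠ 2) (hpN : p ∣ N) (hK : IsImaginaryQuadratic K)
    (hsplit : ((Ideal.span {(p : ℤ)}).primesOver (𝓞 K)).ncard = 2)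
    (h𝔭 : ((p : ℕ) : 𝓞 K) ∈ 𝔭.asIdeal)
    (hℓp : ℓ₀ ≠ p) (hℓ2 : ℓ₀ ≠ 2) (hℓd : (ℓ₀ : ℤ) ∣ NumberField.discr K)
    (hmult₀ : (W.quadraticTwist (((-1 : ℤ) ^ (ℓ₀ / 2) * ℓ₀ : ℤ) : ℚ)).HasMultiplicativeReductionAtPrime ℓ₀)
    (hbc : ∀ v : HeightOneSpectrum (𝓞 K), ((ℓ₀ : ℕ) : 𝓞 K) ∈ v.asIdeal →
      (W.baseChange K).HasMultiplicativeReductionAt v ∧ ¬ (W.baseChange K).HasSplitMultiplicativeReductionAt v)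
    (hsplitq : ∀ ℓ : ℕ, ℓ.Prime → ℓ ∣ N → ℓ ≠ ℓ₀ → ((Ideal.span {(ℓ : ℤ)}).primesOver (𝓞 K)).ncard = 2)
    (hcut : ¬ p ∣ ℓ₀ + 1)
    (hirr : ∀ ρ : ModPGaloisRep K (ZMod p) 2, (W.baseChange K).IsTorsionGaloisRep p ρ →
      FramedRep.IsAbsolutelyIrreducible ρ)
    (hκ : κ.IsAnticyclotomic) (ι' : PadicAlgCl p ≃+* ℂ)
    (hι' : ∀ (w : InfinitePlace K) (k : 𝓞 K), k ∈ 𝔭.asIdeal ↔ ‖ι'.symm (w.embedding (k : K))‖ < 1) :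
    ∃ (ΩK : ℂ) (Ωp : (unrIntegers p)ˣ) (Q : PowerSeries (PadicComplexInt p)), ΩK ≠ 0 ∧
      R1.IsBDPLFunctionInt p ι' 𝔭 κ γ f ΩK ((Ωp : unrIntegers p) : ℂ_[p]) Q ∧ HasUnitContent Q := by
  have hγ : κ.IsTopGenerator γ := Fact.out
  obtain ⟨lam, rlam, hunit, hinfl, hAQ, hunrl, havl, hfacl⟩ := lambdaSupplyAt hp2 ι' K κ hK hκ
  obtain ⟨A, ΩK₀, C, Ωp, Q₀, hA0, hΩK₀, hC, hQ₀, n, hn⟩ :=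
    hB ι' K 𝔭 κ γ W f ℓ₀ lam rlam hp2 hfW hK hsplit h𝔭 hι' hℓp hℓ2 hℓd hmult₀ hbc hsplitq hcut hirr hunit
      hinfl hAQ hunrl havl hfacl hκ hγ
  obtain ⟨ΩK, c, hΩK, hc, hQ⟩ :=
    exists_isBDPLFunctionInt_of_isHsiehLFunction ι' 𝔭 κ γ f hpN hA0 hΩK₀ hC
      ((Ωp : unrIntegers p) : ℂ_[p]) hQ₀
  refine ⟨ΩK, Ωp, _, hΩK, hQ, n, ?_⟩
  rw [PowerSeries.coeff_C_mul]
  exact (isUnit_padicComplexInt_of_norm_eq_one hc).mul (isUnit_padicComplexInt_of_norm_eq_one hn)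

/-! ## §3 The anticyclotomic restriction of a CLW pair over a twisted-road configuration -/

/-- **The anticyclotomic restriction of a CLW pair at a TWISTED-road configuration** (sibling of `TameAnticycRestriction.exists_frame_and_restriction`):
for `W/ℚ` globally minimal with `p ≥ 5` additive (`Addv W p`), `ρ̄_{E,p}` onto, `K` imaginary quadratic with `p` split, an odd `ℓ₀ ≠ p` RAMIFIED in
`K` with `W^{(ℓ₀*)}` multiplicative at `ℓ₀`, `E/K` non-split multiplicative above `ℓ₀`, every other `ℓ ∣ N` split, `p ∤ ℓ₀ + 1`, and Hsieh 2014
Thm. B (twisted reading) as `hB`: for every anticyclotomic datum `(κ, γ, 𝔭, 𝔭′, ι′)` with `𝔭` induced by `ι′`, every completing pair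
`(κ₁, γ₁)` and every CLW pair `(A, B)` with genuine period data, there are a ♭-frame `(Ω_K′, Ω_p′, Q′)` at `(ι′, 𝔭, κ, γ, f)` and `D ≠ 0`
with `A(0,·) = B(0,·)·D`, `(D) ⊆ (Q′)` (§2's unit-content frame, then `TameAnticycRestriction.exists_constantCoeff_eq_mul`). CONDITIONAL on `hB`.
[cite: Hsieh2014, Thm. B p. 713 (Doc. Math. 19)] [cite: CastellaLiuWan2022, (1.0.3) p. 3 and Thm. 8.2.1 p. 85 (Forum Math. Sigma 10 (2022) e110)]
[cite: Castella2018, Thm. 3.1 (arXiv:1704.06608 p. 9)] -/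
theorem exists_frame_and_restriction_twisted
    (hB : Hsieh2014.thmB_exists_isHsiehLFunction_coeff_norm_eq_one_unrPeriod_ramifiedTwistedSteinberg)
    (W : WeierstrassCurve ℚ) [W.IsElliptic] (p : ℕ) [Fact p.Prime] (K : Type) [Field K] [NumberField K]
    [W.IsGloballyMinimal] (hp5 : 5 ≤ p) (hadd : Addv W p) (hsurj : Surj W p) (hK : IsImaginaryQuadratic K)
    (hsplit : ((Ideal.span {(p : ℤ)}).primesOver (𝓞 K)).ncard = 2)
    {ℓ₀ : ℕ} [Fact ℓ₀.Prime] (hℓp : ℓ₀ ≠ p) (hℓ2 : ℓ₀ ≠ 2) (hℓd : (ℓ₀ : ℤ) ∣ NumberField.discr K)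
    (hmult₀ : (W.quadraticTwist (((-1 : ℤ) ^ (ℓ₀ / 2) * ℓ₀ : ℤ) : ℚ)).HasMultiplicativeReductionAtPrime ℓ₀)
    (hbc : ∀ v : HeightOneSpectrum (𝓞 K), ((ℓ₀ : ℕ) : 𝓞 K) ∈ v.asIdeal →
      (W.baseChange K).HasMultiplicativeReductionAt v ∧ ¬ (W.baseChange K).HasSplitMultiplicativeReductionAt v)
    (hsplitq : ∀ ℓ : ℕ, ℓ.Prime → ℓ ∣ W.conductorNorm ℤ → ℓ ≠ ℓ₀ →
      ((Ideal.span {(ℓ : ℤ)}).primesOver (𝓞 K)).ncard = 2)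
    (hcut : ¬ p ∣ ℓ₀ + 1)
    {N : ℕ} [NeZero N] (Dt : ModularParametrizationData W N) (hN : W.conductorNorm ℤ = N)
    (κ : ZpExtension K p) (hκ : κ.IsAnticyclotomic) (γ : absoluteGaloisGroup K) [hγ : Fact (κ.IsTopGenerator γ)]
    (𝔭 : HeightOneSpectrum (𝓞 K)) (h𝔭 : ((p : ℕ) : 𝓞 K) ∈ 𝔭.asIdeal) (𝔭' : HeightOneSpectrum (𝓞 K))
    (ι' : PadicAlgCl p ≃+* ℂ)
    (hind : ∀ (w : InfinitePlace K) (k : 𝓞 K), k ∈ 𝔭.asIdeal ↔ ‖ι'.symm (w.embedding (k : K))‖ < 1)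
    (κ₁ : ZpExtension K p) (γ₁ : absoluteGaloisGroup K) [hpair : Fact (ZpExtension.IsTopGeneratorPair κ₁ κ γ₁ γ)]
    (Ωinf C : ℂ) (Ωp : (unrIntegers p)ˣ) (A B : PowerSeries (PowerSeries (PadicComplexInt p)))
    (hΩinf : Ωinf ≠ 0) (hC : ‖((ι'.symm C : PadicAlgCl p) : ℂ_[p])‖ = 1)
    (hAB : IsCastellaLiuWanLFunction₂ ι' 𝔭' κ₁ κ γ₁ γ Dt.f Ωinf C ((Ωp : unrIntegers p) : ℂ_[p]) A B) :
    ∃ (ΩK' : ℂ) (Ωp' : ℂ_[p]) (Q' D : PowerSeries (PadicComplexInt p)),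
      ΩK' ≠ 0 ∧ Ωp' ≠ 0 ∧ R1.IsBDPLFunctionInt p ι' 𝔭 κ γ Dt.f ΩK' Ωp' Q' ∧
      PowerSeries.constantCoeff A = PowerSeries.constantCoeff B * D ∧ D ≠ 0 ∧
        Ideal.span {D} ≤ Ideal.span {Q'} := by
  have hp : p.Prime := Fact.out
  have hp2 : p ≠ 2 := by omega
  have h2 : Module.finrank ℚ K = 2 := hK.1
  -- `a_p(f) = 0`, `p ∣ N`
  have hap : cuspCoeff Dt.f p = 0 := by
    rw [Dt.isNewformOf.2 p, W.LFunction_apply_eq_zero_of_not_good_of_not_mult p hadd.1 hadd.2 (dvd_refl p),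
      Int.cast_zero]
  have hpN : p ∣ N := by
    rw [← hN]; exact (W.dvd_conductorNorm_iff_not_hasGoodReductionAtPrime p).mpr hadd.1
  have hsplitq' : ∀ ℓ : ℕ, ℓ.Prime → ℓ ∣ N → ℓ ≠ ℓ₀ → ((Ideal.span {(ℓ : ℤ)}).primesOver (𝓞 K)).ncard = 2 := by
    rw [← hN]; exact hsplitq
  -- (irr_K) from `Surj`
  have hirr : ∀ ρ : ModPGaloisRep K (ZMod p) 2, (W.baseChange K).IsTorsionGaloisRep p ρ →
      FramedRep.IsAbsolutelyIrreducible ρ :=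
    fun ρ hρ ↦ SignedBaseChangeK1FrameData.irrK_framed_of_surj W p hp2 hsurj K h2 ρ hρ
  -- the ♭-frame of unit content (Hsieh Thm. B, twisted reading)
  obtain ⟨ΩK', Ωp', Q', hΩK', hQ', hμ⟩ :=
    exists_frameInt_unitContent_twisted hB W K 𝔭 κ γ Dt.f Dt.isNewformOf ℓ₀ hp2 hpN hK hsplit h𝔭 hℓp hℓ2 hℓd hmult₀
      hbc hsplitq' hcut hirr hκ ι' hind
  have hΩp'0 : ((Ωp' : unrIntegers p) : ℂ_[p]) ≠ 0 := fun h ↦ Ωp'.ne_zero (by exact_mod_cast h)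
  have hΩp0 : ((Ωp : unrIntegers p) : ℂ_[p]) ≠ 0 := fun h ↦ Ωp.ne_zero (by exact_mod_cast h)
  have hQ'0 : Q' ≠ 0 := by
    obtain ⟨n, hn⟩ := hμ
    intro h
    rw [h, map_zero] at hn
    exact not_isUnit_zero hn
  obtain ⟨D, hAD, hD0, hDQ⟩ := TameAnticycRestriction.exists_constantCoeff_eq_mul hp2 hK hpN hap hκ hγ.out
    (Fact.out : ZpExtension.IsTopGeneratorPair κ₁ κ γ₁ γ).apply_left hΩinf hC hΩK' hΩp0 hΩp'0 hAB hQ'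
  exact ⟨ΩK', _, Q', D, hΩK', hΩp'0, hQ', hAD, hD0 hQ'0, hDQ⟩

end Summit.BirchSwinnertonDyer.BirchSwinnertonDyer.Theorems.TwistedWanRoad

end
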